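import Summits.CriticalPhenomena.CardyFormulaZ2.Theses.CardySelfRefinement
import Literature.Probability.Percolation.InterfaceTraversalBoundData3
import Mathlib.MeasureTheory.Measure.Tight
import HarnessLib

/-!
# Aizenman–Burchard tightness of the bond-`ℤ²` interface laws of a general discretisation family

Helper file for the registered stub `stub_tournamentTransfer_tightness` of line
`hitting-tournament` of crux `LagHandOff` (stmt-CriticalPhenomena-10268), step (c) of the
tournament transfer: for EVERY admissible `ℤ²`-discretisation family `E` of a Dobrushin domain
`D` (`ZdDiscretisationFamily D E`: domain `D.carrier`, mesh `δ`, arbitrary wired / dual-wired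
arcs, admissible for all small `δ`), the laws of the interfaces `bondInterfaceIn D (E δ)` under
critical bond percolation, `δ ∈ (0, δ₀]`, form a tight set of measures on `CurveClass ℂ` for some
`δ₀ > 0` (Aizenman–Burchard, Duke Math. J. 99 (1999), Thm 1.2, with hypothesis H1 from
Appendix A Thm A.1).

The tree proves this for the CANONICAL data `dobrushinData D δ`
(`isTightLaws_map_bondInterface_holds`, `InterfaceTraversalBound.lean`) and carries the
deterministic core over to arbitrary data `⟨D.carrier, δ, arcA, arcB⟩` in
`InterfaceTraversalBoundData{,2,3}.lean` (`arms_of_hasTraversals_data`). The last file of that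
series, `InterfaceTraversalBoundData4.lean`, is NOT imported here: its import cone contains
`InterfaceScalingLimitDiscretised.lean`, which declares a second constant
`Literature.Probability.Percolation.bondInterfaceIn` and would make the short name of the crux's
`bondInterfaceIn` (the `InterfaceCurves.lean` one) ambiguous in the line's skeleton. Instead the
three assembly steps of that file are reproduced here verbatim (up to the namespace):

* `shortDistanceCutoff_family` — (C0)/(H0), the lattice short-distance cutoff for arbitrary
  data (AB99 §1.a);
* `traversalBound_family` — (C1)/(H1), the power bound on multiple shell traversals, uniformly
  over all admissible data with domain `D` and mesh `δ` (AB99 eq. (1.3), App. A Thm A.1), through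
  the tree's `arms_of_hasTraversals_data`, the iterated BK–Reimer inequality
  `measureReal_disjointOccurrencePow_le`, the RSW one-crossing bound
  `annulusOpenCrossing_half_le_holds` and self-duality `bondPercolation_map_dualConfig_holds`;
* `isTightMeasureSet_map_bondInterfaceIn_family` — the abstract criterion
  `isTightMeasureSet_of_traversalBounds` (AB99 Thms 1.1–1.2) applied to the re-oriented
  exploration curves, on `δ ∈ (0, δ₂]` for admissible data;

and `stub_tournamentTransfer_tightness` takes `δ₀` inside the admissibility range of the family
(`ZdDiscretisationFamily.eventually_isZdAdmissible`), so no large-mesh step is needed.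

References: M. Aizenman, A. Burchard, Duke Math. J. 99 (1999) 419–453, Thms 1.1–1.2, §1.a,
Appendix A; F. Camia, C. M. Newman, PTRF 139 (2007), §2; S. Smirnov, C. R. Acad. Sci. Paris 333
(2001), §2.
-/

noncomputable section

open MeasureTheory Filter Set Topology Metric
open scoped unitInterval BoundedContinuousFunction ENNReal Pointwise
open Literature.Probability.Percolation Literature.Probability.LatticeModels
open Literature.Probability.RandomPlanarGeometry Literature.Probability.Percolation.QuadCrossing
open Literature.Probability.LatticeModels.IsMedialExploration

namespace Summit.CriticalPhenomena.CardyFormulaZ2.Cruxes.LagHandOff.HittingTournament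

/-! ### (H0): the short-distance cutoff for arbitrary data -/

-- adapted from `Literature.Probability.Percolation.shortDistanceCutoff_data`
-- (InterfaceTraversalBoundData4.lean), verbatim; that module is not imported because its cone
-- declares a second `bondInterfaceIn` (see the module docstring)
/-- **(C0) for arbitrary data.** For every Dobrushin domain `D` there are a radius `r₀` and a
number `k₀` such that for every mesh `δ ∈ (0, 1]`, every discrete Dobrushin datum `E` with domain
`D` and mesh `δ` (arbitrary arcs, admissible or not) and every configuration `ω`, the medial
exploration polygon `medialExplorationCurve E ω` lies in `closedBall 0 r₀` and traverses no shell
of inner radius `ρ ≤ δ` by `k₀` separate segments (the polygon uses each medial dart at most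
once and boundedly many darts live near a ball of radius `δ`; junk constant curve otherwise).
Aizenman–Burchard's "short-distance cutoff", quantitative lattice form.
[cite: AizenmanBurchardDuke1999, §1.a] -/
theorem shortDistanceCutoff_family (D : DobrushinDomain) :
    ∃ (r₀ : ℝ) (k₀ : ℕ), 0 ≤ r₀ ∧ ∀ δ ∈ Set.Ioc (0 : ℝ) 1, ∀ E : DiscreteDobrushin,
      E.Ω = D.carrier → E.δ = δ → ∀ ω : BondConfig (Site 2),
      (⟨medialExplorationCurve E ω⟩ : Curve ℂ).range ⊆ closedBall 0 r₀ ∧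
        ∀ (x : ℂ) (ρ R : ℝ), 0 < ρ → ρ ≤ δ → ρ < R →
          ¬ (⟨medialExplorationCurve E ω⟩ : Curve ℂ).HasTraversals k₀ x ρ R := by
  obtain ⟨r, hr⟩ := D.isBounded.subset_closedBall (0 : ℂ)
  refine ⟨max r 0 + 1, 2 * ((2 * 5 + 1) ^ 2 * 4 + 1) + 1, by positivity, fun δ hδ E hΩ hEδ ω ↦ ?_⟩
  obtain ⟨hδ0, hδ1⟩ := hδ
  obtain ⟨Ω', δ', arcA, arcB⟩ := E
  dsimp only at hΩ hEδ
  subst Ω' δ'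
  rw [show (⟨medialExplorationCurve ⟨D.carrier, δ, arcA, arcB⟩ ω⟩ : Curve ℂ) =
    ⟨polyline ((medialExploration ⟨D.carrier, δ, arcA, arcB⟩ ω).map (medialPoint δ))⟩ from rfl]
  rcases medialExploration_eq_nil_or ⟨D.carrier, δ, arcA, arcB⟩ ω with hnil | hexp
  · -- junk constant curve `0`
    rw [hnil, List.map_nil, polyline_nil]
    change (Curve.const (0 : ℂ)).range ⊆ _ ∧ ∀ (x : ℂ) (ρ R : ℝ), 0 < ρ → ρ ≤ δ → ρ < R →
      ¬ (Curve.const (0 : ℂ)).HasTraversals _ x ρ R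
    refine ⟨?_, fun x ρ R _ _ hρR ↦ Curve.not_hasTraversals_const _ (by omega) hρR⟩
    rintro _ ⟨t, rfl⟩
    simp only [Curve.const_apply, mem_closedBall, dist_self]
    positivity
  · -- genuine exploration path
    generalize hγ : medialExploration ⟨D.carrier, δ, arcA, arcB⟩ ω = γ at hexp
    refine ⟨?_, fun x ρ R hρ hρδ hρR ↦ ?_⟩
    · -- the trace lies within `1` of the domain
      rcases γ with _ | ⟨a, _ | ⟨b, l⟩⟩
      · exact (hexp.ne_nil rfl).elim
      · exact (hexp.head_ne_getLast rfl).elim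
      · change Set.range (polylineFrom (medialPoint δ a) ((b :: l).map (medialPoint δ))).2 ⊆ _
        have hpt : ∀ e ∈ a :: b :: l, medialPoint δ e ∈ closedBall (0 : ℂ) (max r 0 + 1) := by
          intro e he
          obtain ⟨p, hp, hep⟩ := exists_mem_zip_of_mem (a :: b :: l) (by simp) he
          obtain ⟨v, f, hvf, hf, hs, ht⟩ := hexp.step p.1 p.2 (infix_of_mem_zip_tail _ hp)
          have hv : meshPoint δ v ∈ closedBall (0 : ℂ) r :=
            hr (meshPoint_mem_of_isCorner_of_isInnerFace hvf hf)
          have hd : dist (medialPoint δ e) (meshPoint δ v) ≤ δ := by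
            rcases hep with rfl | rfl
            · rw [← hs]; exact dist_medialPoint_cornerSource_le hδ0.le hvf
            · rw [← ht]; exact dist_medialPoint_cornerTarget_le hδ0.le hvf
          rw [mem_closedBall] at hv ⊢
          linarith [dist_triangle (medialPoint δ e) (meshPoint δ v) 0, le_max_left r 0]
        exact range_polylineFrom_subset (convex_closedBall 0 _) (hpt a (by simp))
          fun p hp ↦ by
            obtain ⟨e, he, rfl⟩ := List.mem_map.1 hp
            exact hpt e (List.mem_cons_of_mem _ he)
    · -- no `k₀` traversals of shells of inner radius `ρ ≤ δ`
      refine not_hasTraversals_polyline_of_isMedialExploration hexp hρR (nearestSite δ x) 5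
        fun p hp v f hvf hf hs ht hmeet i ↦ ?_
      refine abs_sub_nearestSite_le (K := 4) hδ0 ?_ (by norm_num) i
      obtain ⟨z, hzseg, hzball⟩ := hmeet
      dsimp only at hzseg
      have h1 : dist (medialPoint δ p.1) (meshPoint δ v) ≤ δ := by
        rw [← hs]; exact dist_medialPoint_cornerSource_le hδ0.le hvf
      have h2 : dist (medialPoint δ p.2) (meshPoint δ v) ≤ δ := by
        rw [← ht]; exact dist_medialPoint_cornerTarget_le hδ0.le hvf
      have h12 : dist (medialPoint δ p.2) (medialPoint δ p.1) ≤ 2 * δ := by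
        linarith [dist_triangle (medialPoint δ p.2) (meshPoint δ v) (medialPoint δ p.1),
          dist_comm (meshPoint δ v) (medialPoint δ p.1)]
      have hz : dist z (medialPoint δ p.1) ≤ 2 * δ := by
        have hsub := (convex_closedBall (medialPoint δ p.1) (2 * δ)).segment_subset
          (mem_closedBall_self (by positivity)) (mem_closedBall.2 h12)
        exact mem_closedBall.1 (hsub hzseg)
      rw [mem_closedBall] at hzball
      linarith [dist_triangle (meshPoint δ v) (medialPoint δ p.1) x,
        dist_triangle (medialPoint δ p.1) z x, dist_comm (medialPoint δ p.1) (meshPoint δ v),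
        dist_comm z (medialPoint δ p.1)]

/-! ### (H1): the traversal bound, uniformly over the data -/

-- adapted from `Literature.Probability.Percolation.traversalBound_data`
-- (InterfaceTraversalBoundData4.lean), verbatim
/-- **Power bound on multiple shell crossings, uniformly over admissible data** — hypothesis H1
of Aizenman–Burchard (Duke Math. J. 99 (1999), eq. (1.3) and Appendix A Thm A.1) for the medial
exploration path of critical bond percolation `P_{1/2}` on `δℤ²`, in the tree's formulation
(`bondExploration_traversalBound`: shell-dependent threshold, small mesh), for EVERY admissible
discrete Dobrushin datum `E` with domain `D` and mesh `δ`: the threshold `k`, the constants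
`K, λ` and the mesh bound `δ₀` depend on the Jordan domain `D` only (through a modulus of uniform
continuity of `∂D` and the RSW/BK constants), not on the arcs of `E`. Same proof as
`bondExploration_traversalBound_holds` (`arms_of_hasTraversals_data`, iterated BK–Reimer
`measureReal_disjointOccurrencePow_le`, one-crossing bound `annulusOpenCrossing_half_le_holds`,
self-duality `bondPercolation_map_dualConfig_holds`).
[cite: AizenmanBurchardDuke1999, §1.b (1.3) and Appendix A Thm A.1] -/
theorem traversalBound_family (D : DobrushinDomain) :
    ∃ (k : ℂ → ℝ → ℝ → ℕ) (K lam δ₀ : ℝ), 0 ≤ K ∧ 2 < lam ∧ 0 < δ₀ ∧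
      ∀ δ ∈ Set.Ioc (0 : ℝ) δ₀, ∀ E : DiscreteDobrushin, E.Ω = D.carrier → E.δ = δ →
        E.IsZdAdmissible → ∀ (x : ℂ) (ρ R : ℝ), δ ≤ ρ → ρ < R → R ≤ 1 →
          bondPercolation (zdGraph 2) half
              {ω | (⟨medialExplorationCurve E ω⟩ : Curve ℂ).HasTraversals (k x ρ R) x ρ R} ≤
            ENNReal.ofReal (K * (ρ / R) ^ lam) := by
  classical
  obtain ⟨α, c₀, hα, hc₀, hone⟩ := annulusOpenCrossing_half_le_holds
  set C : ℝ := max 16 c₀ with hCdef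
  have hC : (16 : ℝ) ≤ C := le_max_left _ _
  have hCc₀ : c₀ ≤ C := le_max_right _ _
  set j₀ : ℕ := ⌈3 / α⌉₊ + 1 with hj₀
  have hαj₀ : (3 : ℝ) ≤ α * j₀ := by
    have h1 : 3 / α ≤ (⌈3 / α⌉₊ : ℝ) := Nat.le_ceil _
    have h2 : (⌈3 / α⌉₊ : ℝ) ≤ (j₀ : ℝ) := by rw [hj₀]; push_cast; linarith
    calc (3 : ℝ) = α * (3 / α) := by field_simp
      _ ≤ α * j₀ := mul_le_mul_of_nonneg_left (h1.trans h2) hα.le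
  have hmodex : ∀ η : ℝ, 0 < η →
      ∃ θ : ℝ, 0 < θ ∧ ∀ s t : ℝ, |s - t| < θ → dist (D.boundary s) (D.boundary t) < η :=
    fun η hη => Literature.Probability.Percolation.JordanDomain.exists_modulus D.toJordanDomain hη
  set θf : ℝ → ℝ := fun ρ => if h : 0 < ρ then (hmodex ρ h).choose else 1 with hθf
  have hθf_spec : ∀ ρ (h : 0 < ρ), 0 < θf ρ ∧
      ∀ s t : ℝ, |s - t| < θf ρ → dist (D.boundary s) (D.boundary t) < ρ := by
    intro ρ h
    simp only [hθf, dif_pos h]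
    exact (hmodex ρ h).choose_spec
  set kf : ℂ → ℝ → ℝ → ℕ := fun _ ρ _ => (2 * j₀ + ⌊1 / θf ρ⌋₊ + 2).choose 2 + 3 with hkf
  set K : ℝ := max ((16 * C) ^ (3 : ℕ)) (2 * (8 * (C + 3)) ^ (α * j₀)) with hKdef
  have hK16 : (16 * C) ^ (3 : ℕ) ≤ K := le_max_left _ _
  have hK2 : 2 * (8 * (C + 3)) ^ (α * j₀) ≤ K := le_max_right _ _
  refine ⟨kf, K, 3, 1, le_trans (by positivity) hK16, by norm_num, one_pos, ?_⟩
  intro δ hδ E hΩ hEδ hadm x ρ R hδρ hρR hR1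
  obtain ⟨Ω', δ', arcA, arcB⟩ := E
  dsimp only at hΩ hEδ
  subst Ω' δ'
  obtain ⟨hδ0, -⟩ := hδ
  have hρ : 0 < ρ := hδ0.trans_le hδρ
  have hR : 0 < R := hρ.trans hρR
  set P := bondPercolation (zdGraph 2) half with hP
  have hrpow : (ρ / R) ^ (3 : ℝ) = (ρ / R) ^ (3 : ℕ) := by
    rw [show (3 : ℝ) = ((3 : ℕ) : ℝ) by norm_num, Real.rpow_natCast]
  rw [hrpow]
  by_cases hreg : 16 * C * ρ ≤ R
  swap
  · -- small ratio: the bound is `≥ 1`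
    refine (prob_le_one).trans ?_
    rw [← ENNReal.ofReal_one]
    apply ENNReal.ofReal_le_ofReal
    push Not at hreg
    have h1 : 1 ≤ 16 * C * (ρ / R) := by
      rw [mul_div_assoc', le_div_iff₀ hR]; linarith
    calc (1 : ℝ) ≤ (16 * C * (ρ / R)) ^ (3 : ℕ) := one_le_pow₀ h1
      _ = (16 * C) ^ (3 : ℕ) * (ρ / R) ^ (3 : ℕ) := by ring
      _ ≤ K * (ρ / R) ^ (3 : ℕ) := by gcongr
  · -- the genuine estimate
    obtain ⟨hθ, hmod⟩ := hθf_spec ρ hρ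
    set r' := C * ρ + 3 * δ with hr'
    set R' := R / 4 - 3 * δ with hR'
    set A := annulusOpenCrossing x δ r' R' with hA
    set S := disjointOccurrencePow A j₀ with hS
    have hCρ : 16 * ρ ≤ C * ρ := mul_le_mul_of_nonneg_right hC hρ.le
    have hr'0 : 0 ≤ r' / R' := div_nonneg (by rw [hr']; positivity) (by rw [hR']; linarith)
    -- the event is inside `S ∪ dualConfig ⁻¹' S`
    have hsub : {ω | (⟨medialExplorationCurve ⟨D.carrier, δ, arcA, arcB⟩ ω⟩ :
        Curve ℂ).HasTraversals (kf x ρ R) x ρ R} ⊆ S ∪ dualConfig ⁻¹' S := by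
      intro ω hω
      simp only [mem_setOf_eq] at hω
      rcases medialExploration_eq_nil_or ⟨D.carrier, δ, arcA, arcB⟩ ω with hnil | hexp
      · -- junk constant curve: no traversal
        exfalso
        obtain ⟨s, t, hst, -⟩ := hω
        have hk0 : 0 < kf x ρ R := by simp [hkf]
        obtain ⟨i⟩ : Nonempty (Fin (kf x ρ R)) := Fin.pos_iff_nonempty.1 hk0
        have h := (hst i).2
        have e : ∀ u, (⟨medialExplorationCurve ⟨D.carrier, δ, arcA, arcB⟩ ω⟩ : Curve ℂ) u = 0 := by
          intro u
          show medialExplorationCurve ⟨D.carrier, δ, arcA, arcB⟩ ω u = 0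
          rw [medialExplorationCurve, hnil]; simp
        rw [e, e] at h
        rcases h with ⟨h1, h2⟩ | ⟨h1, h2⟩ <;> linarith
      · obtain ⟨b, l', hbl⟩ := List.exists_cons_of_ne_nil hexp.ne_nil
        rw [hbl] at hexp
        have hcurve : (⟨medialExplorationCurve ⟨D.carrier, δ, arcA, arcB⟩ ω⟩ : Curve ℂ) =
            ⟨polyline ((b :: l').map (medialPoint δ))⟩ := by
          show (⟨medialExplorationCurve ⟨D.carrier, δ, arcA, arcB⟩ ω⟩ : Curve ℂ) = _
          rw [medialExplorationCurve, hbl]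
        rw [hcurve] at hω
        rcases arms_of_hasTraversals_data hδ0 hadm hexp hδρ hC hreg hθ hmod (j₀ := j₀) (le_rfl) hω
          with h | h
        · exact Or.inl h
        · exact Or.inr h
    -- probabilities
    have hPS : P S ≤ ENNReal.ofReal ((r' / R') ^ (α * j₀)) := by
      have hloc := isLocalEvent_annulusOpenCrossing hδ0 x r' R'
      have h1 := measureReal_disjointOccurrencePow_le (zdGraph 2) half hloc j₀
      have h2 : P.real A ≤ (r' / R') ^ α :=
        hone x δ r' R' hδ0 (by rw [hr']; nlinarith) (by rw [hr', hR']; linarith)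
      have h3 : P.real S ≤ ((r' / R') ^ α) ^ j₀ := h1.trans (pow_le_pow_left₀ measureReal_nonneg h2 j₀)
      rw [← Real.rpow_natCast, ← Real.rpow_mul hr'0] at h3
      calc P S = ENNReal.ofReal (P.real S) := (ENNReal.ofReal_toReal (measure_ne_top _ _)).symm
        _ ≤ ENNReal.ofReal ((r' / R') ^ (α * j₀)) := ENNReal.ofReal_le_ofReal h3
    have hPdual : P (dualConfig ⁻¹' S) ≤ P S := by
      calc P (dualConfig ⁻¹' S) ≤ P.map dualConfig S :=
            Measure.le_map_apply measurable_dualConfig.aemeasurable _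
        _ = P S := by
          rw [hP, bondPercolation_map_dualConfig_holds half,
            show unitInterval.symm half = half from Subtype.ext (by simp [half]; norm_num)]
    -- the real inequality `2 (r'/R')^{αj₀} ≤ K (ρ/R)^3`
    have hratio : r' / R' ≤ 8 * (C + 3) * (ρ / R) := by
      have hR'pos : 0 < R' := by rw [hR']; linarith
      rw [div_le_iff₀ hR'pos, hr', hR']
      have : 8 * (C + 3) * (ρ / R) * (R / 4 - 3 * δ) =
          (C + 3) * ρ * 2 - 8 * (C + 3) * (ρ / R) * 3 * δ := by
        field_simp
        ring
      nlinarith [mul_pos hρ hR, div_nonneg hρ.le hR.le,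
        mul_nonneg (by linarith : (0:ℝ) ≤ C + 3) (div_nonneg hρ.le hR.le)]
    have hreal : 2 * (r' / R') ^ (α * j₀) ≤ K * (ρ / R) ^ (3 : ℕ) := by
      have hexp0 : 0 ≤ α * j₀ := by positivity
      have h1 : (r' / R') ^ (α * j₀) ≤ (8 * (C + 3) * (ρ / R)) ^ (α * j₀) :=
        Real.rpow_le_rpow hr'0 hratio hexp0
      have hρR : ρ / R ≤ 1 := (div_le_one hR).2 hρR.le
      have hρR0 : 0 ≤ ρ / R := div_nonneg hρ.le hR.le
      have h2 : (8 * (C + 3) * (ρ / R)) ^ (α * j₀) =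
          (8 * (C + 3)) ^ (α * j₀) * (ρ / R) ^ (α * j₀) :=
        Real.mul_rpow (by positivity) hρR0
      have h3 : (ρ / R) ^ (α * j₀) ≤ (ρ / R) ^ (3 : ℕ) := by
        rw [← Real.rpow_natCast]
        exact Real.rpow_le_rpow_of_exponent_ge (div_pos hρ hR) hρR (by push_cast; exact hαj₀)
      calc 2 * (r' / R') ^ (α * j₀)
          ≤ 2 * ((8 * (C + 3)) ^ (α * j₀) * (ρ / R) ^ (α * j₀)) := by rw [← h2]; linarith
        _ ≤ 2 * ((8 * (C + 3)) ^ (α * j₀) * (ρ / R) ^ (3 : ℕ)) := by gcongr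
        _ = (2 * (8 * (C + 3)) ^ (α * j₀)) * (ρ / R) ^ (3 : ℕ) := by ring
        _ ≤ K * (ρ / R) ^ (3 : ℕ) := by gcongr
    calc P {ω | (⟨medialExplorationCurve ⟨D.carrier, δ, arcA, arcB⟩ ω⟩ :
          Curve ℂ).HasTraversals (kf x ρ R) x ρ R}
        ≤ P (S ∪ dualConfig ⁻¹' S) := measure_mono hsub
      _ ≤ P S + P (dualConfig ⁻¹' S) := measure_union_le _ _
      _ ≤ ENNReal.ofReal ((r' / R') ^ (α * j₀)) + ENNReal.ofReal ((r' / R') ^ (α * j₀)) :=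
          add_le_add hPS (hPdual.trans hPS)
      _ = ENNReal.ofReal (2 * (r' / R') ^ (α * j₀)) := by
          rw [← ENNReal.ofReal_add (Real.rpow_nonneg hr'0 _) (Real.rpow_nonneg hr'0 _)]; ring_nf
      _ ≤ ENNReal.ofReal (K * (ρ / R) ^ (3 : ℕ)) := ENNReal.ofReal_le_ofReal hreal

/-! ### Tightness of the interface laws of families of data -/

/-- The crux's interface map `bondInterfaceIn D E` (`InterfaceCurves.lean`) is the class of the
re-oriented exploration curve, with the re-orientation `orientCurve` of
`InterfaceScalingLimit.lean` (the two copies of `orientCurve` have the same body, so this is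
definitional). (Smirnov 2001, §2.) [cite: Smirnov2001, §2] -/
theorem bondInterfaceIn_eq_mk_comp_orientCurve (D : DobrushinDomain) (E : DiscreteDobrushin) :
    bondInterfaceIn D E =
      CurveClass.mk ∘ fun ω ↦
        Literature.Probability.Percolation.orientCurve D (medialExplorationCurve E ω) :=
  rfl

-- adapted from `Literature.Probability.Percolation.isTightMeasureSet_map_bondInterfaceIn`
-- (InterfaceTraversalBoundData4.lean), verbatim up to the interface map (the crux's
-- `bondInterfaceIn` of `InterfaceCurves.lean`, definitionally the same object)
/-- **Tightness of the bond interface laws near `δ = 0`, for families of admissible data**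
(Aizenman–Burchard 1999, Thm 1.2): if `E δ` has domain `D`, mesh `δ` and is admissible for all
`δ ∈ (0, δ₂]`, `δ₂` below the mesh bound of `traversalBound_family` and `1`, then the laws
`P_{1/2}.map (bondInterfaceIn D (E δ))`, `δ ∈ (0, δ₂]`, form a tight set of measures on
`CurveClass ℂ` — the abstract criterion `isTightMeasureSet_of_traversalBounds` in `E = ℂ` with
`Λ = closedBall 0 r₀`, the random curves `orientCurve D (medialExplorationCurve (E δ) ·)`
(whose classes are `bondInterfaceIn D (E δ)`; traces and traversal counts are those of the
exploration polygon, `hasTraversals_orientCurve_iff`), (H0) from `shortDistanceCutoff_family`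
and (H1) from `traversalBound_family`. [cite: AizenmanBurchardDuke1999, Thm 1.2] -/
theorem isTightMeasureSet_map_bondInterfaceIn_family (D : DobrushinDomain) :
    ∃ δ₃ > 0, ∀ (E : ℝ → DiscreteDobrushin) (δ₂ : ℝ), δ₂ ≤ δ₃ →
      (∀ δ, 0 < δ → δ ≤ δ₂ → (E δ).Ω = D.carrier ∧ (E δ).δ = δ ∧ (E δ).IsZdAdmissible) →
      IsTightMeasureSet
        ((fun δ ↦ (bondPercolation (zdGraph 2) half).map (bondInterfaceIn D (E δ))) ''
          Set.Ioc 0 δ₂) := by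
  obtain ⟨r₀, k₀, hr₀, hcut⟩ := shortDistanceCutoff_family D
  obtain ⟨k, K, lam, δ₀, hK, hlam, hδ₀, hbd⟩ := traversalBound_family D
  refine ⟨min δ₀ 1, lt_min hδ₀ one_pos, fun E δ₂ hδ₂ hadm ↦ ?_⟩
  have hT : Set.Ioc 0 δ₂ ⊆ Set.Ioc (0 : ℝ) 1 :=
    Set.Ioc_subset_Ioc_right (hδ₂.trans (min_le_right _ _))
  have hT₀ : Set.Ioc 0 δ₂ ⊆ Set.Ioc (0 : ℝ) δ₀ :=
    Set.Ioc_subset_Ioc_right (hδ₂.trans (min_le_left _ _))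
  have key := isTightMeasureSet_of_traversalBounds (E := ℂ) (isCompact_closedBall (0 : ℂ) r₀)
    (C := 9 * (r₀ + 2) ^ 2) (d := 2) zero_le_two
    (fun ρ hρ hρ1 ↦ exists_finset_card_le_cover_closedBall hr₀ ρ hρ hρ1)
    (Ω := fun _ ↦ BondConfig (Site 2)) (fun _ ↦ bondPercolation (zdGraph 2) half)
    (fun δ ω ↦ Literature.Probability.Percolation.orientCurve D (medialExplorationCurve (E δ) ω))
    (fun x ρ R ↦ max k₀ (k x ρ R)) hK hlam hT ?_ ?_
  · simpa only [bondInterfaceIn_eq_mk_comp_orientCurve] using key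
  · -- (H0) from (C0), for every `ω`
    intro δ hδ
    obtain ⟨hΩ, hEδ, -⟩ := hadm δ hδ.1 hδ.2
    refine ae_of_all _ fun ω ↦ ⟨?_, fun x ρ R hρ hρδ hρR htr ↦ ?_⟩
    · rw [curveRange_orientCurve]
      exact (hcut δ (hT hδ) (E δ) hΩ hEδ ω).1
    · rw [hasTraversals_orientCurve_iff] at htr
      exact (hcut δ (hT hδ) (E δ) hΩ hEδ ω).2 x ρ R hρ hρδ hρR (htr.of_le (le_max_left _ _))
  · -- (H1) from (C1)
    intro δ hδ x ρ R hδρ hρR hR1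
    obtain ⟨hΩ, hEδ, had⟩ := hadm δ hδ.1 hδ.2
    refine le_trans (measure_mono fun ω hω ↦ ?_)
      (hbd δ (hT₀ hδ) (E δ) hΩ hEδ had x ρ R hδρ hρR hR1)
    simp only [mem_setOf_eq, hasTraversals_orientCurve_iff] at hω ⊢
    exact hω.of_le (le_max_right _ _)

/-- **Aizenman–Burchard tightness of the interface laws of a general admissible
`ℤ²`-discretisation family** (step (c) of the tournament transfer of line `hitting-tournament`):
for every Dobrushin domain `D` and every `ZdDiscretisationFamily D E` there is `δ₀ > 0` such
that the laws of `bondInterfaceIn D (E δ)` under critical bond percolation, `δ ∈ (0, δ₀]`, form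
a tight set of measures on `CurveClass ℂ`: take `δ₀` below the admissibility threshold of the
family (`eventually_isZdAdmissible`) and below the mesh bound of
`isTightMeasureSet_map_bondInterfaceIn_family`. (Aizenman–Burchard 1999, Thm 1.2, bond-`ℤ²`
exploration interface.) [cite: AizenmanBurchardDuke1999, Thm 1.2] -/
theorem stub_tournamentTransfer_tightness : ∀ (D : DobrushinDomain) (E : ℝ → DiscreteDobrushin), ZdDiscretisationFamily D E → ∃ δ₀ : ℝ, 0 < δ₀ ∧ IsTightMeasureSet ((fun δ => (bondPercolation (zdGraph 2) half).map (bondInterfaceIn D (E δ))) '' Set.Ioc 0 δ₀) := by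
  intro D E hE
  obtain ⟨δ₃, hδ₃, htight⟩ := isTightMeasureSet_map_bondInterfaceIn_family D
  have hadm := hE.eventually_isZdAdmissible
  rw [eventually_nhdsWithin_iff, Metric.eventually_nhds_iff] at hadm
  obtain ⟨ε, hε, hadm⟩ := hadm
  refine ⟨min (ε / 2) δ₃, lt_min (by positivity) hδ₃, ?_⟩
  refine htight E (min (ε / 2) δ₃) (min_le_right _ _) fun δ hδ0 hδle ↦
    ⟨hE.Ω_eq δ, hE.δ_eq δ, hadm ?_ hδ0⟩
  rw [Real.dist_eq, sub_zero, abs_of_pos hδ0]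
  exact hδle.trans_lt ((min_le_left _ _).trans_lt (by linarith))

end Summit.CriticalPhenomena.CardyFormulaZ2.Cruxes.LagHandOff.HittingTournament

end
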